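import Literature.AlgebraicGeometry.Motives.KunnethH1Fibre
import HarnessLib

/-!
# Künneth injectivity for `Ȟ¹(𝒪)` on the fibres of `X ×_A Y → Spec A` over a RING `A` (field-valued points)

Layer `Literature/AlgebraicGeometry/Motives`, namespace `Literature.AlgebraicGeometry.Motives`.  THEOREMS ONLY (no definition,
no named fact, no instance, no notation).  Cell `hodgecm-mathlib` (D-0151), F-2d road (R-def) «theorem of the cube over a
non-reduced base by Artinian induction», Step (I) brick Č4a (author B-p07 (g15)).

★ `Motives/KunnethH1Fibre.kunneth_cechH1_bc_slices_injective` transports the Künneth injectivity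
`Ȟ¹(𝒰, 𝒪_{X ×_k Y}) ↪ Ȟ¹({x} × Y) ⊕ Ȟ¹(X × {y})` (★ `kunneth_cechH1_slices_injective_holds`, [GortzWedhorn2023] proof of
Thm. 24.73 with Cor. 22.110) to the fibres `σ^*(X ⊗ Y) = X_κ ×_κ Y_κ` of a product of schemes over a FIELD `K` along
`σ : Spec κ → Spec K`.  Step (I) of [GortzWedhorn2023] Lemma 24.72 for a family over a general base `S` needs the same
statement over a RING: for `X`, `Y` over `Spec A` (`A` any commutative ring, e.g. `𝒪_{S,s}`) with sections `x`, `y` and a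
field-valued point `σ : Spec κ → Spec A` whose fibres `X_κ`, `Y_κ` are proper and geometrically integral (e.g. abelian
schemes), a class in `Ȟ¹(𝒰, 𝒪)` on `σ^*(X ×_A Y)` dying on the base-changed slices `σ^*({x} × Y)`, `σ^*(X × {y})` is zero.  The
proof is ★'s verbatim (monoidality of Mathlib's `Over.pullback σ`, naturality/unitality of its tensorator, functoriality of
`Ȟ¹` ★ `Morphisms/CechH1PullbackComp`) with the properness/integrality hypotheses placed on the FIBRES; the base-change
functor and the induced `κ`-points are spelled inline (`Over.pullback σ`, `ε ≫ σ^*x`).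

* `sliceLeft_pullback`, `sliceRight_pullback` — the slices of `X_κ ⊗ Y_κ` at the induced `κ`-points followed by the
  tensorator are the base changes of the slices (ring form of ★ `sliceLeft_bc`/`sliceRight_bc`).
* **`kunneth_cechH1_pullback_slices_injective`** — the Künneth injectivity on `σ^*(X ⊗ Y)` over a ring `A`.

HC_CM is proved only modulo the 7 printed citations until rung 0 closes; nothing here is about HC.

## References
* [GortzWedhorn2023] U. Görtz, T. Wedhorn, *Algebraic Geometry II* (2023), Cor. 22.110 (p. 399), Lemma 24.72 proof Step (I)
  (p. 409), Thm. 24.73 proof (p. 410).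
-/

noncomputable section

universe u

open CategoryTheory CategoryTheory.Limits AlgebraicGeometry MonoidalCategory CartesianMonoidalCategory
open Literature.AlgebraicGeometry.Morphisms

namespace Literature.AlgebraicGeometry.Motives

variable {A : Type u} [CommRing A] {κ : Type u} [Field κ] (σ : Spec (.of κ) ⟶ Spec (.of A))

/-- **The slice `{x_κ} × Y_κ → X_κ ×_κ Y_κ` is the base change of the slice `{x} × Y → X ×_A Y`** (ring base; up to the
tensorator `μ` of `Over.pullback σ`: naturality and left unitality). [cite: GortzWedhorn2023, Thm. 24.73 proof (p. 410)] -/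
theorem sliceLeft_pullback {X : SchemeOver A} (x : 𝟙_ (SchemeOver A) ⟶ X) (Y : SchemeOver A) :
    ((λ_ ((Over.pullback σ).obj Y)).inv ≫
        (Functor.LaxMonoidal.ε (Over.pullback σ) ≫ (Over.pullback σ).map x) ▷ (Over.pullback σ).obj Y) ≫
        Functor.LaxMonoidal.μ (Over.pullback σ) X Y =
      (Over.pullback σ).map ((λ_ Y).inv ≫ x ▷ Y) := by
  rw [comp_whiskerRight, Category.assoc, Category.assoc, Functor.LaxMonoidal.μ_natural_left,
    Functor.LaxMonoidal.left_unitality_inv_assoc, ← Functor.map_comp]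

/-- **The slice `X_κ × {y_κ} → X_κ ×_κ Y_κ` is the base change of the slice `X × {y} → X ×_A Y`** (ring base).
[cite: GortzWedhorn2023, Thm. 24.73 proof (p. 410)] -/
theorem sliceRight_pullback (X : SchemeOver A) {Y : SchemeOver A} (y : 𝟙_ (SchemeOver A) ⟶ Y) :
    ((ρ_ ((Over.pullback σ).obj X)).inv ≫
        (Over.pullback σ).obj X ◁ (Functor.LaxMonoidal.ε (Over.pullback σ) ≫ (Over.pullback σ).map y)) ≫
        Functor.LaxMonoidal.μ (Over.pullback σ) X Y =
      (Over.pullback σ).map ((ρ_ X).inv ≫ X ◁ y) := by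
  rw [MonoidalCategory.whiskerLeft_comp, Category.assoc, Category.assoc, Functor.LaxMonoidal.μ_natural_right,
    Functor.LaxMonoidal.right_unitality_inv_assoc, ← Functor.map_comp]

/-- **Künneth injectivity for `Ȟ¹(𝒪)` on the fibre `(X ×_A Y) ×_A Spec κ = X_κ ×_κ Y_κ` over a RING `A`** ([GortzWedhorn2023]
Lemma 24.72 Step (I) with the proof of Thm. 24.73: «for all `t ∈ T` this map is of the form `H¹(X_s ×_{κ(s)} Y_s) ⊗ κ(t) →
…`», injective by the Künneth formula): for `X`, `Y` over `Spec A` with sections `x`, `y`, a field-valued point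
`σ : Spec κ → Spec A` whose fibres `X_κ`, `Y_κ` are proper and geometrically integral, any covering `𝒰` of `σ^*(X ×_A Y)` by
affine opens and `c ∈ Ȟ¹(𝒰, 𝒪)`: if the pullbacks of `c` along the base-changed slices `σ^*({x} × Y)` and `σ^*(X × {y})`
vanish, then `c = 0` (pull back along the tensorator `μ : X_κ ⊗ Y_κ ≅ (X ⊗ Y)_κ`, apply ★
`kunneth_cechH1_slices_injective_holds` over `κ`, return along `μ⁻¹`).
[cite: GortzWedhorn2023, Thm. 24.73 proof p. 410 with Cor. 22.110 p. 399] [cite: GortzWedhorn2023, Lemma 24.72 proof Step (I) (p. 409)] -/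
theorem kunneth_cechH1_pullback_slices_injective (X Y : SchemeOver A)
    [IsProper ((Over.pullback σ).obj X).hom] [IsProper ((Over.pullback σ).obj Y).hom]
    [GeometricallyIntegral ((Over.pullback σ).obj X).hom] [GeometricallyIntegral ((Over.pullback σ).obj Y).hom]
    (x : 𝟙_ (SchemeOver A) ⟶ X) (y : 𝟙_ (SchemeOver A) ⟶ Y) {ι : Type u}
    (U : ι → ((Over.pullback σ).obj (X ⊗ Y)).left.Opens) (hU : ∀ i, IsAffineOpen (U i))
    (hcov : ⨆ i, U i = ⊤) (c : CechH1 ((Over.pullback σ).obj (X ⊗ Y)).hom U)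
    (hx : cechComapH1 ((Over.pullback σ).obj (X ⊗ Y)).hom ((Over.pullback σ).obj Y).hom
        ((Over.pullback σ).map ((λ_ Y).inv ≫ x ▷ Y)).left (Over.w _) U c = 0)
    (hy : cechComapH1 ((Over.pullback σ).obj (X ⊗ Y)).hom ((Over.pullback σ).obj X).hom
        ((Over.pullback σ).map ((ρ_ X).inv ≫ X ◁ y)).left (Over.w _) U c = 0) :
    c = 0 := by
  -- the tensorator `μ : X_κ ⊗ Y_κ ≅ (X ⊗ Y)_κ` and its inverse, on underlying schemes
  let μ : (Over.pullback σ).obj X ⊗ (Over.pullback σ).obj Y ≅ (Over.pullback σ).obj (X ⊗ Y) :=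
    Functor.Monoidal.μIso (Over.pullback σ) X Y
  have hμ : μ.hom.left ≫ ((Over.pullback σ).obj (X ⊗ Y)).hom = ((Over.pullback σ).obj X ⊗ (Over.pullback σ).obj Y).hom :=
    Over.w μ.hom
  have hμ' : μ.inv.left ≫ ((Over.pullback σ).obj X ⊗ (Over.pullback σ).obj Y).hom = ((Over.pullback σ).obj (X ⊗ Y)).hom :=
    Over.w μ.inv
  haveI : IsIso μ.hom.left := inferInstanceAs (IsIso ((Over.forget _).map μ.hom))
  -- the class pulled back to `X_κ ⊗ Y_κ` vanishes by Künneth over `κ`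
  have hc' : cechComapH1 _ _ μ.hom.left hμ U c = 0 := by
    refine kunneth_cechH1_slices_injective_holds κ ((Over.pullback σ).obj X) ((Over.pullback σ).obj Y)
      (Functor.LaxMonoidal.ε (Over.pullback σ) ≫ (Over.pullback σ).map x)
      (Functor.LaxMonoidal.ε (Over.pullback σ) ≫ (Over.pullback σ).map y) ι (preimageFamily μ.hom.left U)
      (fun i => (hU i).preimage μ.hom.left) ?_ _ ?_ ?_
    · change ⨆ i, μ.hom.left ⁻¹ᵁ U i = ⊤
      rw [← Scheme.Hom.preimage_iSup, hcov, Scheme.Hom.preimage_top]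
    · have e : ((λ_ ((Over.pullback σ).obj Y)).inv ≫
          (Functor.LaxMonoidal.ε (Over.pullback σ) ≫ (Over.pullback σ).map x) ▷ (Over.pullback σ).obj Y).left ≫ μ.hom.left =
          ((Over.pullback σ).map ((λ_ Y).inv ≫ x ▷ Y)).left := by
        rw [← Over.comp_left, Functor.Monoidal.μIso_hom, sliceLeft_pullback]
      exact (cechComapH1_comp _ _ _ μ.hom.left
        ((λ_ ((Over.pullback σ).obj Y)).inv ≫
          (Functor.LaxMonoidal.ε (Over.pullback σ) ≫ (Over.pullback σ).map x) ▷ (Over.pullback σ).obj Y).left U hμ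
          (Over.w _) c).trans
          ((cechComapH1_congr_eq_zero_iff _ U e _ (Over.w _) c).2 hx)
    · have e : ((ρ_ ((Over.pullback σ).obj X)).inv ≫
          (Over.pullback σ).obj X ◁ (Functor.LaxMonoidal.ε (Over.pullback σ) ≫ (Over.pullback σ).map y)).left ≫ μ.hom.left =
          ((Over.pullback σ).map ((ρ_ X).inv ≫ X ◁ y)).left := by
        rw [← Over.comp_left, Functor.Monoidal.μIso_hom, sliceRight_pullback]
      exact (cechComapH1_comp _ _ _ μ.hom.left
        ((ρ_ ((Over.pullback σ).obj X)).inv ≫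
          (Over.pullback σ).obj X ◁ (Functor.LaxMonoidal.ε (Over.pullback σ) ≫ (Over.pullback σ).map y)).left U hμ
          (Over.w _) c).trans
          ((cechComapH1_congr_eq_zero_iff _ U e _ (Over.w _) c).2 hy)
  -- return along `μ⁻¹`
  have e1 : μ.inv.left ≫ μ.hom.left = 𝟙 _ := by
    rw [← Over.comp_left, Iso.inv_hom_id, Over.id_left]
  have key : cechComapH1 _ _ (μ.inv.left ≫ μ.hom.left)
      (comp_comp_eq _ _ _ μ.hom.left μ.inv.left hμ hμ') U c = 0 := by
    rw [← cechComapH1_comp _ _ _ μ.hom.left μ.inv.left U hμ hμ']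
    exact (congrArg (cechComapH1 _ _ μ.inv.left hμ' (preimageFamily μ.hom.left U)) hc').trans
      (map_zero _)
  rw [cechComapH1_congr_eq_zero_iff _ U e1 _ (Category.id_comp _) c, cechComapH1_id] at key
  exact key

end Literature.AlgebraicGeometry.Motives

end
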